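import Mathlib
import Summits.Ventures.PercRepro2.Defs
import Summits.Ventures.PercRepro2.Independence
import Summits.Ventures.PercRepro2.Harris
import Summits.Ventures.PercRepro2.Graph
import Summits.Ventures.PercRepro2.OneColourSwitch
import Summits.Ventures.PercRepro2.M9ClusterAvoidHarris

/-!
# Harris on a SUB-CUBE of colourings (blind cell PercRepro2, p3 g37, 2026-08-29;
`proofs/P3-POCKETRK.md` §5″ Step 3)

The sub-cube `{ω : ω = ω₀ off R}` (the edges outside `R` pinned to `ω₀`) carries the product
weights `p = 1/2` on `R` and `0 / 1` off `R` (`pinWeights`, admissible); its expectation is the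
normalised sum over the sub-cube (`expect_pin`).  Harris–FKG for these weights gives, for an
antitone `a`, a monotone `Y` and an antitone `W` with `Σ_{sub-cube} Y ≤ Σ_{sub-cube} W`,
`Σ_{sub-cube} a · (Y − W) ≤ 0` (`sum_subcube_antitone_mul_sub_nonpos`), hence
`Σ_{sub-cube ∩ A} σ_pq ≤ 0` for every lower set `A` of colourings whenever the sub-cube has
`Σ 1[p ~_Y q] ≤ Σ 1[p ~_W q]` (`sum_subcube_sigma_pq_of_isLowerSet_nonpos`) — the exploration
fibre of the pocket proof (the edges touching `d`'s `Y`-cluster pinned, the rest free).  Own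
work; std axioms.
-/

namespace Summit.Ventures.PercRepro2

namespace NoPocket

open Finset Classical OneColourSwitch

variable {E : Type*} [Fintype E] [DecidableEq E]

section Pin

/-- The sub-cube of the colourings agreeing with `ω₀` off `R`. -/
lemma mem_subcube_iff (R : Finset E) (ω₀ ω : Config E) :
    ω ∈ univ.filter (fun ω : Config E => ∀ e ∉ R, ω e = ω₀ e) ↔ ∀ e ∉ R, ω e = ω₀ e := by
  simp

omit [Fintype E] in
/-- The pinned weights `1/2` on `R`, `0 / 1` off `R` (following `ω₀`) are admissible. -/
lemma isProbVec_pin (R : Finset E) (ω₀ : Config E) :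
    IsProbVec (fun e => if e ∈ R then (1 / 2 : ℚ) else if ω₀ e then 1 else 0) :=
  ⟨fun e => by split_ifs <;> norm_num, fun e => by split_ifs <;> norm_num⟩

/-- The pinned weight of a colouring: `(1/2)^|R|` on the sub-cube, `0` off it. -/
lemma weight_pin (R : Finset E) (ω₀ ω : Config E) :
    weight (fun e => if e ∈ R then (1 / 2 : ℚ) else if ω₀ e then 1 else 0) ω =
      if (∀ e ∉ R, ω e = ω₀ e) then (1 / 2 : ℚ) ^ R.card else 0 := by
  simp only [weight, edgeFactor]
  by_cases h : ∀ e ∉ R, ω e = ω₀ e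
  · rw [if_pos h]
    rw [← Finset.prod_mul_prod_compl R]
    have h1 : ∀ e ∈ R, (if ω e then (if e ∈ R then (1 / 2 : ℚ) else if ω₀ e then 1 else 0)
        else 1 - (if e ∈ R then (1 / 2 : ℚ) else if ω₀ e then 1 else 0)) = 1 / 2 := by
      intro e he
      rw [if_pos he]
      split_ifs <;> norm_num
    have h2 : ∀ e ∈ Rᶜ, (if ω e then (if e ∈ R then (1 / 2 : ℚ) else if ω₀ e then 1 else 0)
        else 1 - (if e ∈ R then (1 / 2 : ℚ) else if ω₀ e then 1 else 0)) = 1 := by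
      intro e he
      have he' : e ∉ R := Finset.mem_compl.1 he
      rw [if_neg he', h e he']
      cases ω₀ e <;> simp
    rw [Finset.prod_congr rfl h1, Finset.prod_congr rfl h2, Finset.prod_const,
      Finset.prod_const_one, mul_one]
  · rw [if_neg h]
    obtain ⟨e, he, hne⟩ : ∃ e, e ∉ R ∧ ω e ≠ ω₀ e := by
      by_contra hcon
      exact h fun e he => by_contra fun hne => hcon ⟨e, he, hne⟩
    refine Finset.prod_eq_zero (Finset.mem_univ e) ?_
    rw [if_neg he]
    cases h1 : ω e <;> cases h2 : ω₀ e <;> simp_all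

/-- The pinned expectation is the normalised sum over the sub-cube. -/
lemma expect_pin (R : Finset E) (ω₀ : Config E) (f : Config E → ℚ) :
    expect (fun e => if e ∈ R then (1 / 2 : ℚ) else if ω₀ e then 1 else 0) f =
      (1 / 2 : ℚ) ^ R.card *
        ∑ ω ∈ univ.filter (fun ω : Config E => ∀ e ∉ R, ω e = ω₀ e), f ω := by
  simp only [expect, weight_pin, Finset.mul_sum, Finset.sum_filter]
  refine Finset.sum_congr rfl fun ω _ => ?_
  split_ifs <;> simp

/-- **Harris on a sub-cube for a decreasing weight**: for an antitone `a` with non-negative total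
on the sub-cube, a monotone `Y` and an antitone `W` with `Σ Y ≤ Σ W` on the sub-cube,
`Σ_{sub-cube} a · (Y − W) ≤ 0`. -/
theorem sum_subcube_antitone_mul_sub_nonpos (R : Finset E) (ω₀ : Config E)
    {a Y W : Config E → ℚ} (ha : Antitone a) (hY : Monotone Y) (hW : Antitone W)
    (ha0 : 0 ≤ ∑ ω ∈ univ.filter (fun ω : Config E => ∀ e ∉ R, ω e = ω₀ e), a ω)
    (hYW : ∑ ω ∈ univ.filter (fun ω : Config E => ∀ e ∉ R, ω e = ω₀ e), Y ω ≤
      ∑ ω ∈ univ.filter (fun ω : Config E => ∀ e ∉ R, ω e = ω₀ e), W ω) :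
    ∑ ω ∈ univ.filter (fun ω : Config E => ∀ e ∉ R, ω e = ω₀ e), a ω * (Y ω - W ω) ≤ 0 := by
  set S := univ.filter (fun ω : Config E => ∀ e ∉ R, ω e = ω₀ e) with hS
  set c : ℚ := (1 / 2 : ℚ) ^ R.card with hc
  have hcpos : 0 < c := by positivity
  have h1 : (c * ∑ ω ∈ S, -a ω) * (c * ∑ ω ∈ S, Y ω) ≤ c * ∑ ω ∈ S, -a ω * Y ω := by
    have := expect_mul_expect_le_expect_mul (isProbVec_pin R ω₀) (f := fun ω => -a ω) (g := Y)
      (fun x y hxy => neg_le_neg (ha hxy)) hY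
    simpa only [expect_pin, Pi.mul_apply] using this
  have h2 : (c * ∑ ω ∈ S, -a ω) * (c * ∑ ω ∈ S, -W ω) ≤ c * ∑ ω ∈ S, -a ω * -W ω := by
    have := expect_mul_expect_le_expect_mul (isProbVec_pin R ω₀) (f := fun ω => -a ω)
      (g := fun ω => -W ω) (fun x y hxy => neg_le_neg (ha hxy))
      (fun x y hxy => neg_le_neg (hW hxy))
    simpa only [expect_pin, Pi.mul_apply] using this
  have hs1 : ∑ ω ∈ S, -a ω = -∑ ω ∈ S, a ω := by rw [Finset.sum_neg_distrib]
  have hs2 : ∑ ω ∈ S, -W ω = -∑ ω ∈ S, W ω := by rw [Finset.sum_neg_distrib]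
  have hs3 : ∑ ω ∈ S, -a ω * Y ω = -∑ ω ∈ S, a ω * Y ω := by
    rw [← Finset.sum_neg_distrib]
    exact Finset.sum_congr rfl fun ω _ => by ring
  have hs4 : ∑ ω ∈ S, -a ω * -W ω = ∑ ω ∈ S, a ω * W ω :=
    Finset.sum_congr rfl fun ω _ => by ring
  rw [hs1, hs3] at h1
  rw [hs1, hs2, hs4] at h2
  have e1 : ∑ ω ∈ S, a ω * (Y ω - W ω) = ∑ ω ∈ S, a ω * Y ω - ∑ ω ∈ S, a ω * W ω := by
    rw [← Finset.sum_sub_distrib]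
    exact Finset.sum_congr rfl fun ω _ => by ring
  rw [e1]
  set SA := ∑ ω ∈ S, a ω with hSA
  set SY := ∑ ω ∈ S, Y ω with hSY
  set SW := ∑ ω ∈ S, W ω with hSW
  set SAY := ∑ ω ∈ S, a ω * Y ω with hSAY
  set SAW := ∑ ω ∈ S, a ω * W ω with hSAW
  have h1' : c * SAY ≤ c * (c * SA * SY) := by nlinarith [h1]
  have h2' : c * (c * SA * SW) ≤ c * SAW := by nlinarith [h2]
  have h1'' : SAY ≤ c * SA * SY := le_of_mul_le_mul_left h1' hcpos
  have h2'' : c * SA * SW ≤ SAW := le_of_mul_le_mul_left h2' hcpos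
  have h3 : c * SA * SY ≤ c * SA * SW :=
    mul_le_mul_of_nonneg_left hYW (mul_nonneg hcpos.le ha0)
  linarith

end Pin

section Percolation

variable {V : Type*} {ends : E → Sym2 V}

/-- **Harris on a sub-cube for a decreasing event**: on the sub-cube `{ω = ω₀ off R}`, if
`Σ 1[p ~_Y q] ≤ Σ 1[p ~_W q]`, then `Σ_{sub-cube ∩ A} σ_pq ≤ 0` for every lower set `A`. -/
theorem sum_subcube_sigma_pq_of_isLowerSet_nonpos (R : Finset E) (ω₀ : Config E)
    {A : Set (Config E)} (hA : IsLowerSet A) (p q : V)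
    (hYW : (∑ ω ∈ univ.filter (fun ω : Config E => ∀ e ∉ R, ω e = ω₀ e),
        if Conn ends ω p q then (1 : ℚ) else 0) ≤
      ∑ ω ∈ univ.filter (fun ω : Config E => ∀ e ∉ R, ω e = ω₀ e),
        if Conn ends (OneColourSwitch.compl ω) p q then (1 : ℚ) else 0) :
    (∑ ω ∈ univ.filter (fun ω : Config E => ∀ e ∉ R, ω e = ω₀ e),
      if ω ∈ A then sigma ends ω p q else 0) ≤ 0 := by
  have key := sum_subcube_antitone_mul_sub_nonpos (E := E) R ω₀
    (a := fun ω => if ω ∈ A then (1 : ℚ) else 0)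
    (Y := fun ω => if Conn ends ω p q then (1 : ℚ) else 0)
    (W := fun ω => if Conn ends (OneColourSwitch.compl ω) p q then (1 : ℚ) else 0)
    (fun ω ω' h => by
      dsimp only
      by_cases hm : ω' ∈ A
      · rw [if_pos hm, if_pos (hA h hm)]
      · rw [if_neg hm]
        split_ifs <;> norm_num)
    (monotone_connY p q) (antitone_connW p q)
    (Finset.sum_nonneg fun ω _ => by split_ifs <;> norm_num) hYW
  have hcast : (((∑ ω ∈ univ.filter (fun ω : Config E => ∀ e ∉ R, ω e = ω₀ e),
      if ω ∈ A then sigma ends ω p q else 0 : ℤ)) : ℚ) =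
      ∑ ω ∈ univ.filter (fun ω : Config E => ∀ e ∉ R, ω e = ω₀ e),
        (if ω ∈ A then (1 : ℚ) else 0) *
        ((if Conn ends ω p q then (1 : ℚ) else 0) -
          (if Conn ends (OneColourSwitch.compl ω) p q then (1 : ℚ) else 0)) := by
    push_cast
    refine Finset.sum_congr rfl fun ω _ => ?_
    by_cases hm : ω ∈ A
    · rw [if_pos hm, if_pos hm, one_mul, sigma_cast]
    · rw [if_neg hm, if_neg hm, zero_mul]
  have : (((∑ ω ∈ univ.filter (fun ω : Config E => ∀ e ∉ R, ω e = ω₀ e),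
      if ω ∈ A then sigma ends ω p q else 0 : ℤ)) : ℚ) ≤ 0 := by
    rw [hcast]; exact key
  exact_mod_cast this

end Percolation

end NoPocket

end Summit.Ventures.PercRepro2
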